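import Summits.Ventures.PercRepro.C025ProfilePLDClosureParallel

/-!
# PER-LAYER DOMINANCE IS PRESERVED BY FREE POINTS (night-3 g31)

`proofs/NIGHT3-G31-TWOLIFT.md` §4.  g29's `PLDClosure.pld_disjointSum_parallelClasses` gives (PLD) for `M ⊕ (freeOn univ).comapOn E₂ c`
for every class map `c`; with `c = id` the parallel classes are singletons and the summand is the free matroid on `E₂`
(`comapOn_id_freeOn`, by `Matroid.ext_indep`).  So PER-LAYER DOMINANCE survives adding any finite set of free points
(`pld_disjointSum_freeOn`) — the `m = 2` case of every line, and the coloop step of the closure system as one statement.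
No `def`, no `instance`, no notation.  Axioms: standard.
-/

open scoped Matroid

namespace PercRepro

open Finset ThmH

namespace PLDClosure

variable {α : Type} [DecidableEq α]

omit [DecidableEq α] in
/-- Pulling the free matroid back along the identity is the free matroid on the set. -/
theorem comapOn_id_freeOn (E₂ : Set α) :
    (Matroid.freeOn (Set.univ : Set α)).comapOn E₂ id = Matroid.freeOn E₂ := by
  refine Matroid.ext_indep (by rw [Matroid.comapOn_ground_eq, Matroid.freeOn_ground]) ?_
  intro I _
  rw [Matroid.comapOn_indep_iff, Matroid.freeOn_indep_iff, Matroid.freeOn_indep_iff, Set.image_id]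
  exact ⟨fun h => h.2.2, fun h => ⟨Set.subset_univ _, Set.injOn_id _, h⟩⟩

/-- PER-LAYER DOMINANCE IS PRESERVED BY FREE POINTS: if `M` satisfies the hPLD binder, so does `M ⊕ freeOn E₂`. -/
theorem pld_disjointSum_freeOn (M : Matroid α) [M.Finite]
    (hPLD : ∀ lo hi δ Θ : ℕ, Θ ≤ lo + hi + δ → (lo = 0 ∨ lo + hi + δ ≤ Θ) →
      (∑ I ∈ (gr M).powerset, (if lo ≤ (M.eRk (I : Set α)).toNat ∧ (M.eRk (I : Set α)).toNat ≤ hi ∧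
          Θ ≤ (M.eRk ((gr M \ I : Finset α) : Set α)).toNat + (M.eRk (I : Set α)).toNat then
          ((M.eRk ((gr M \ I : Finset α) : Set α)).toNat).choose δ else 0)) ≤
        ∑ I ∈ (gr M).powerset, (if lo + δ ≤ (M.eRk ((gr M \ I : Finset α) : Set α)).toNat ∧
          (M.eRk ((gr M \ I : Finset α) : Set α)).toNat ≤ hi + δ then
          ((M.eRk ((gr M \ I : Finset α) : Set α)).toNat).choose δ else 0))
    (E₂ : Finset α) (h : Disjoint M.E (E₂ : Set α)) :
    haveI := PLDBridge.disjointSum_freeOn_finite M E₂ h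
    ∀ lo hi δ Θ : ℕ, Θ ≤ lo + hi + δ → (lo = 0 ∨ lo + hi + δ ≤ Θ) →
      (∑ I ∈ (gr (M.disjointSum (Matroid.freeOn (E₂ : Set α)) h)).powerset, (if lo ≤ ((M.disjointSum (Matroid.freeOn (E₂ : Set α)) h).eRk (I : Set α)).toNat ∧ ((M.disjointSum (Matroid.freeOn (E₂ : Set α)) h).eRk (I : Set α)).toNat ≤ hi ∧
          Θ ≤ ((M.disjointSum (Matroid.freeOn (E₂ : Set α)) h).eRk ((gr (M.disjointSum (Matroid.freeOn (E₂ : Set α)) h) \ I : Finset α) : Set α)).toNat + ((M.disjointSum (Matroid.freeOn (E₂ : Set α)) h).eRk (I : Set α)).toNat then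
          (((M.disjointSum (Matroid.freeOn (E₂ : Set α)) h).eRk ((gr (M.disjointSum (Matroid.freeOn (E₂ : Set α)) h) \ I : Finset α) : Set α)).toNat).choose δ else 0)) ≤
        ∑ I ∈ (gr (M.disjointSum (Matroid.freeOn (E₂ : Set α)) h)).powerset, (if lo + δ ≤ ((M.disjointSum (Matroid.freeOn (E₂ : Set α)) h).eRk ((gr (M.disjointSum (Matroid.freeOn (E₂ : Set α)) h) \ I : Finset α) : Set α)).toNat ∧
          ((M.disjointSum (Matroid.freeOn (E₂ : Set α)) h).eRk ((gr (M.disjointSum (Matroid.freeOn (E₂ : Set α)) h) \ I : Finset α) : Set α)).toNat ≤ hi + δ then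
          (((M.disjointSum (Matroid.freeOn (E₂ : Set α)) h).eRk ((gr (M.disjointSum (Matroid.freeOn (E₂ : Set α)) h) \ I : Finset α) : Set α)).toNat).choose δ else 0) := by
  have key := pld_disjointSum_parallelClasses M hPLD (id : α → α) E₂ h
  have e : (Matroid.freeOn (Set.univ : Set α)).comapOn (E₂ : Set α) id = Matroid.freeOn (E₂ : Set α) :=
    comapOn_id_freeOn _
  simp only [e] at key
  exact key

end PLDClosure

end PercRepro
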